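import Literature.Geometry.Symplectic.SteinPALF
import Literature.Topology.FourManifolds.Handles
import HarnessLib

/-!
# Kas 1980 (Gompf–Stipsicz §8.2; Oba 2016, §2.2): the handle count of a planar positive
# allowable Lefschetz fibration over the disc (named fact)

Topic `Literature/Geometry/Symplectic`.  ONE named fact, no proofs, over the tree's fibration
vocabulary `PALF` (`SteinPALF.lean`) and handle vocabulary `HasHandleDecomposition`
(`Topology/FourManifolds/Handles.lean`).

A. Kas, *On the handlebody decomposition associated to a Lefschetz fibration*, Pacific J. Math.
89 (1980) 89–104 (= R. E. Gompf, A. I. Stipsicz, *4-Manifolds and Kirby Calculus*, §8.2), as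
printed in T. Oba, Geom. Dedicata 183 (2016), **§2.2** (p. 5 of arXiv:1407.5257): "Suppose
`f : X → D²` is a positive Lefschetz fibration with fiber a compact, oriented, connected genus
`g` surface `Σ` with `r` boundary components.  Then `X` admits a handle decomposition
`X = (D² × Σ) ∪ (∪ᵢ h⁽²⁾ᵢ) = (h⁽⁰⁾ ∪ (∪_{j=1}^{2g+r-1} h⁽¹⁾ⱼ)) ∪ (∪_{i=1}^{m} h⁽²⁾ᵢ)`", and
the proof of **Prop. 3.6** (p. 7): "the number of `1`-handles is the first Betti number of
`Σ_{0,n+1}` i.e., `n`, and that of `2`-handles is the number of the vanishing cycles".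

The statement below is the planar case (`g = 0`, `r = n + 1`): a compact connected `W` carrying
a `PALF o b` with planar boundary pages and `n + 1` binding components has a handle
decomposition with one `0`-handle, `n` `1`-handles, one `2`-handle per critical point and no
handle of index `≥ 3` (`HasHandleDecomposition 3 W (1, n, #crit, 0, …)`).  It is, character for
character, the hypothesis `hK` of the ACCEPTED theorems `Oba2016_handleCount_of_wendl_of_kas`,
`Oba2016_steinFilling_twoTubes_of_wendl_of_kas` and
`Oba2016_steinFilling_fourHoledSphere_of_wendl_of_kas_of_cancel`
(`PlanarHomologySphereFillingsPALF.lean`, p154503), vendored as a named fact at the request of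
promote event 4335855 (librarian sweep g40, 2026-08-17), together with its sibling
`Wendl2010_planarStein_palf` (`PlanarSteinLefschetzFibration.lean`): with both,
`Oba2016_steinFilling_fourHoledSphere` is closed for at most two binding tubes
(`Oba2016_steinFilling_twoTubes_of_wendl_of_kas`) and reduced to Oba's §3.2 cancellation endgame
otherwise.  Deliberately NOT here: the incidence of vanishing cycles and cocore arcs (the Kirby
diagram), higher genus, any proof.

## References

* A. Kas, Pacific J. Math. 89 (1980) 89–104, doi:10.2140/pjm.1980.89.89 (main theorem). [Kas1980]
* R. E. Gompf, A. I. Stipsicz, *4-Manifolds and Kirby Calculus*, GSM 20 (1999), §8.2.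
  [GompfStipsiczGSM1999]
* T. Oba, Geom. Dedicata 183 (2016); arXiv:1407.5257: §2.2 (p. 5), proof of Prop. 3.6 (p. 7).
  [Oba2016]
-/

noncomputable section

open Set Function
open scoped Manifold ContDiff Topology

namespace Literature.Geometry.Symplectic

open Literature.Topology.FourManifolds

/-- **Kas 1980 / Gompf–Stipsicz §8.2, planar fibres (Oba 2016, §2.2 and proof of Prop. 3.6).**
A compact connected `4`-manifold `W` carrying a positive allowable Lefschetz fibration
`P : PALF o b` over the disc whose boundary open book has planar pages and whose binding has
`n + 1` connected components admits a handle decomposition with exactly one `0`-handle, `n`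
`1`-handles ("the first Betti number of `Σ_{0,n+1}`"), `P.crit.card` `2`-handles ("the number of
the vanishing cycles") and no handle of index `≥ 3`.  Verbatim the hypothesis `hK` of
`Oba2016_steinFilling_fourHoledSphere_of_wendl_of_kas_of_cancel`.
[cite: Kas1980, main theorem (handlebody of a Lefschetz fibration over D²)]
[cite: Oba2016, §2.2 (p. 5 of arXiv:1407.5257) and proof of Prop. 3.6 (p. 7)] -/
def Kas1980_planarPALF_handleCount : Prop :=
  ∀ (W : Type) [TopologicalSpace W] [T2Space W] [SecondCountableTopology W]
    [ChartedSpace (EuclideanHalfSpace 4) W] [IsManifold (𝓡∂ 4) ∞ W] [CompactSpace W]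
    [ConnectedSpace W] (o : SmoothOrientation (𝓡∂ 4) W) (b : BoundaryData (𝓡∂ 4) W (𝓡 3))
    (P : PALF o b) (n : ℕ), P.ob.IsPlanar →
    Nat.card (ConnectedComponents P.ob.binding) = n + 1 →
    HasHandleDecomposition 3 W
      (fun k => if k = 0 then 1 else if k = 1 then n else if k = 2 then P.crit.card else 0)

end Literature.Geometry.Symplectic

end
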